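import Summits.CriticalPhenomena.SAWScalingLimit.Theses.SAWCompassLattice
import Summits.CriticalPhenomena.SAWScalingLimit.Theses.SAWParafermion
import Summits.CriticalPhenomena.SAWScalingLimit.Theses.SAWTrackTransport
import Summits.CriticalPhenomena.SAWScalingLimit.Theorems.SAWDevelopingMapHexTransferLineReduction
import Summits.CriticalPhenomena.SAWScalingLimit.Theorems.SAWCompassLatticeSurfaceUniversalityNonVacuity
import Summits.CriticalPhenomena.SAWScalingLimit.Theorems.SubseqIdentification.Negative.ProbabilityRedundant
import Literature.Probability.RandomPlanarGeometry.SLEConvergenceCriterion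
import Literature.Probability.RandomPlanarGeometry.PortGadgetLattice
import Mathlib.MeasureTheory.Measure.Portmanteau

/-!
# Line `lipschitz_toll` for the crux `SurfaceUniversality` (stmt-CriticalPhenomena-6964)

Route `SAWCompassLattice` (sub-problem `SAWScalingLimit`), crux `SurfaceUniversality` (rank 3, XL):
for every compass solution, every Dobrushin domain `D`, every `ℤ²` endpoint approximation `(a, b)`
and every port endpoint approximation `(a', b')` at `Θ ≡ π/2`, the critical `ℤ²` SAW law `SAW.law`
and the compass chordal law `SAW.compassLaw` merge on ALL bounded continuous test functions of
`CurveClass ℂ` as `δ → 0⁺` (`Surface.surfaceUniversality_iff`, `Iff.rfl`).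

ALTERNATIVE LINE (crux-strategist; the live skeleton `Lines/birth.lean` is untouched). THE CUT:
merging on all of `C_b(CurveClass ℂ)` is split into

* ONE-SIDED TIGHTNESS of the `ℤ²` family — the shared open item stmt-CriticalPhenomena-1881
  (`SAWParafermion.EventualTight`, eventual tightness `IsTightAlongMesh` of the critical `ℤ²` SAW
  curve laws; wanted by 15 routes, implied by the `(0, δ₀]`-form stmt-1372): `stub_tightZ2`;
* merging on BOUNDED LIPSCHITZ test functions only (equivalently: the bounded-Lipschitz /
  Lévy–Prokhorov distance between the two curve laws tends to `0`), cut at GM's Yang–Baxter walk: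
  - `stub_lipPlusPointIsZ2 : LipPlusPointIsZ2` — the `ℤ²` side only (conventions + boundary-layer /
    endpoint locality of the critical chordal `ℤ²` law, at bounded-Lipschitz level): `SAW.law`
    (sites, `discreteDomainGraph`, endpoints `a_δ, b_δ`) vs the critical PLUS-lattice law `plusLaw`
    (`ℤ²` SAW on the face centres of `meshFaces (π/2) Ω δ`, port endpoints `a'_δ, b'_δ`);
  - `stub_lipPlusToYB : LipPlusToYB` — THE KERNEL (hardest): the critical plus law vs GM's
    critical Yang–Baxter law `ybLaw (π/2) Ω δ 1 a' b'` drawn by `YBWalk.curve` — same faces, same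
    ports, same endpoints; in GM's face-weight language the uniform walk is the point
    `(u, v, w) = (x_c, x_c, 0)` and the integrable walk the point `(u₁, v, w₁)(π/2)`;
  - the third leg, GM's law vs the compass law, is PROVED here for bounded Lipschitz `f`
    (`lipPortCoupling`: `‖∫ f∘curve d ybLaw − ∫ f d compassLaw‖ ≤ L·|δ|`, from the landed port
    dictionary `Sketch.stub_portDictionary` and the landed `O(δ)` drawing coupling
    `PortTransfer.dist_compassCurve_curve_le`) — at `C_b` level this leg needs a limit
    (`TollReduction.lean` pays `YBSquareSLE` for it); at Lipschitz level it is free.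

COMPOSITION (sorry-free, the analytic heart of the line): `tendsto_sub_of_isTightAlongMesh` — if
ONE of two families of laws on the Polish space `CurveClass ℂ` is tight along `δ → 0⁺` and the two
merge on bounded Lipschitz functions, they merge on all bounded continuous functions (subsequence
principle `Filter.tendsto_of_subseq_tendsto` + Prokhorov along the mesh
`IsTightAlongMesh.exists_subseq` + the bounded-Lipschitz portmanteau criterion
`MeasureTheory.tendsto_iff_forall_lipschitz_integral_tendsto`; no tightness of the second family
is needed: its convergence along the subsequence is READ OFF the Lipschitz merging). Hence
`SurfaceUniversality_of : SAWCompassLattice.SurfaceUniversality` BY NAME from the three stubs.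

WHY THIS CUT (what it dodges). (1) Birth's `stub_plusPointIsZ2` / `stub_surfaceTransport` are
`C_b`-merging statements; without tightness a deterministic `O(δ)` coupling does NOT give
`C_b`-merging (non-compactness of `CurveClass ℂ`), so every conventions step of birth secretly
needs a tightness-strength input; here every coupling step is an inequality (`lipPortCoupling` is
the model). (2) `TollReduction.lean`: `YBSquareSLE → YBtoUniform → SurfaceUniversality` pays the
SLE(8/3) identification of GM's walk; here the toll is `EventualTight` of the `ℤ²` walk alone — no
identification, no conformal invariance, a hypothesis 15 routes already want — and `YBtoUniform`
is only needed on Lipschitz functions (sorry-free companion workfile `TightToll.lean`: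
`surfaceUniversality_of_tight_of_ybToUniform : EventualTight → YBtoUniform → SurfaceUniversality`).
(3) The kernel is now a METRIC statement (`d_BL → 0`), measurable by simulation (cheapest
falsifier) and attackable by couplings that are good with high probability, scale by scale.

Disproof used: none exists for this crux (`ledger crux ls`: no `Disproof.lean`, no `Negative/`).
Negatives index: every statement is eventual in `δ` (`IsTightAlongMesh`, `𝓝[>] 0`); the refuted
all-`δ` tightness stmt-0772 (`SAWParafermion.Tight`, `IsTightLaws` over `(0,1]`) is NOT used —
`stub_tightZ2` is its repaired form stmt-1881.
-/

noncomputable section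

namespace Summit.CriticalPhenomena.SAWScalingLimit.Cruxes.SurfaceUniversality.LipschitzToll

open MeasureTheory Filter Topology Set
open scoped NNReal ENNReal BoundedContinuousFunction
open Literature.Probability.RandomPlanarGeometry
open Literature.Probability.RandomPlanarGeometry.SAW
open Literature.Probability.RandomPlanarGeometry.SAW.YangBaxter
open Literature.Probability.LatticeModels (Site)
open Summit.CriticalPhenomena.SAWScalingLimit.Theses
open Summit.CriticalPhenomena.SAWScalingLimit.Cruxes.HexTransfer.Sketch

/-! ### Generic: one-sided tightness upgrades bounded-Lipschitz merging to `C_b` merging -/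

section Generic

variable {Ω : ℝ → Type*} [∀ δ, MeasurableSpace (Ω δ)]

/-- **One-sided Prokhorov upgrade.** Let `Y δ : Ω δ → CurveClass ℂ` be random curve classes under
laws `P δ` (probability measures making `Y δ` a.e.-measurable for small `δ`) forming a TIGHT family
along `δ → 0⁺`, and let `ν δ` be probability measures on `CurveClass ℂ` for small `δ` (NO tightness
assumed). If `E[g(Y δ)] − ∫ g dν δ → 0` for every bounded Lipschitz `g`, then
`E[f(Y δ)] − ∫ f dν δ → 0` for every bounded continuous `f`. Proof: by the subsequence principle
it suffices to extract, from every sequence of meshes `s n → 0⁺`, a subsequence along which the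
difference tends to `0`; Prokhorov along the mesh gives a subsequence with `Y ⇒ μ`; then `ν ⇒ μ`
on bounded Lipschitz functions, hence weakly (bounded-Lipschitz portmanteau), hence on `f`.
[cite: BillingsleyCPM1999, Thm. 5.1 and Thm. 2.6] -/
theorem tendsto_sub_of_isTightAlongMesh {Y : ∀ δ, Ω δ → CurveClass ℂ} {P : ∀ δ, Measure (Ω δ)}
    {ν : ℝ → Measure (CurveClass ℂ)}
    (hP : ∀ᶠ δ in 𝓝[>] (0 : ℝ), IsProbabilityMeasure (P δ))
    (hY : ∀ᶠ δ in 𝓝[>] (0 : ℝ), AEMeasurable (Y δ) (P δ))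
    (hT : IsTightAlongMesh Y P)
    (hν : ∀ᶠ δ in 𝓝[>] (0 : ℝ), IsProbabilityMeasure (ν δ))
    (hLip : ∀ (g : CurveClass ℂ →ᵇ ℝ) (L : ℝ≥0), LipschitzWith L g →
      Tendsto (fun δ => (∫ ω, g (Y δ ω) ∂P δ) - ∫ x, g x ∂ν δ) (𝓝[>] (0 : ℝ)) (𝓝 0))
    (f : CurveClass ℂ →ᵇ ℝ) :
    Tendsto (fun δ => (∫ ω, f (Y δ ω) ∂P δ) - ∫ x, f x ∂ν δ) (𝓝[>] (0 : ℝ)) (𝓝 0) := by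
  classical
  -- surrogate probability laws on the curve space, equal to the push-forward laws for small `δ`
  obtain ⟨ρ, hρ⟩ : ∃ ρ : ℝ → Measure (CurveClass ℂ), ∀ δ, ρ δ =
      if IsProbabilityMeasure ((P δ).map (Y δ)) then (P δ).map (Y δ)
      else Measure.dirac (CurveClass.mk (Curve.const 0)) :=
    ⟨_, fun _ => rfl⟩
  have hρprob : ∀ δ, IsProbabilityMeasure (ρ δ) := by
    intro δ
    by_cases h : IsProbabilityMeasure ((P δ).map (Y δ))
    · rw [hρ δ, if_pos h]
      exact h
    · rw [hρ δ, if_neg h]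
      infer_instance
  have hev : ∀ᶠ δ in 𝓝[>] (0 : ℝ), AEMeasurable (Y δ) (P δ) ∧ ρ δ = (P δ).map (Y δ) := by
    filter_upwards [hP, hY] with δ hPδ hYδ
    haveI := hPδ
    refine ⟨hYδ, ?_⟩
    rw [hρ δ, if_pos (Measure.isProbabilityMeasure_map hYδ)]
  have hTρ : IsTightAlongMesh (Ωδ := fun _ : ℝ => CurveClass ℂ)
      (fun (_ : ℝ) (x : CurveClass ℂ) => x) ρ := by
    intro ε hε
    obtain ⟨K, hK, hb⟩ := hT ε hε
    refine ⟨K, hK, ?_⟩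
    filter_upwards [hb, hev] with δ hδ hδ'
    have hpre : (fun x : CurveClass ℂ => x) ⁻¹' Kᶜ = Kᶜ := rfl
    rw [hpre, hδ'.2,
      Measure.map_apply_of_aemeasurable hδ'.1 hK.isClosed.isOpen_compl.measurableSet]
    exact hδ
  haveI : ∀ δ, IsProbabilityMeasure (ρ δ) := hρprob
  refine tendsto_of_subseq_tendsto fun s hs => ?_
  obtain ⟨φ, μ, hφ, hμ, hlim⟩ :=
    hTρ.exists_subseq (Filter.Eventually.of_forall fun δ => aemeasurable_id') hs
  refine ⟨φ, ?_⟩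
  have ht : Tendsto (fun n => s (φ n)) atTop (𝓝[>] (0 : ℝ)) := hs.comp hφ.tendsto_atTop
  -- (i) the tight side converges to `μ` along `s ∘ φ`, on every bounded continuous function
  have hA : ∀ g : CurveClass ℂ →ᵇ ℝ,
      Tendsto (fun n => ∫ ω, g (Y (s (φ n)) ω) ∂P (s (φ n))) atTop (𝓝 (∫ x, g x ∂μ)) := by
    intro g
    refine (hlim g).congr' ?_
    filter_upwards [ht.eventually hev] with n hn
    change ∫ x, g x ∂ρ (s (φ n)) = _
    rw [hn.2, integral_map hn.1 g.continuous.aestronglyMeasurable]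
  -- (ii) the other side converges to `μ` along `s ∘ φ`, on bounded Lipschitz functions
  have hB : ∀ (g : CurveClass ℂ →ᵇ ℝ) (L : ℝ≥0), LipschitzWith L g →
      Tendsto (fun n => ∫ x, g x ∂ν (s (φ n))) atTop (𝓝 (∫ x, g x ∂μ)) := by
    intro g L hL
    have h1 : Tendsto (fun n => (∫ ω, g (Y (s (φ n)) ω) ∂P (s (φ n))) - ∫ x, g x ∂ν (s (φ n)))
        atTop (𝓝 0) := (hLip g L hL).comp ht
    have h2 := (hA g).sub h1
    rw [sub_zero] at h2
    exact h2.congr fun n => sub_sub_cancel _ _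
  -- (iii) surrogate probability measures on the `ν` side; bounded-Lipschitz portmanteau
  let ν' : ℕ → ProbabilityMeasure (CurveClass ℂ) := fun n =>
    if h : IsProbabilityMeasure (ν (s (φ n))) then ⟨ν (s (φ n)), h⟩ else ⟨μ, hμ⟩
  have hν' : ∀ᶠ n in atTop, ((ν' n : ProbabilityMeasure (CurveClass ℂ)) : Measure (CurveClass ℂ))
      = ν (s (φ n)) := by
    filter_upwards [ht.eventually hν] with n hn
    show ((if h : IsProbabilityMeasure (ν (s (φ n))) then (⟨ν (s (φ n)), h⟩ : ProbabilityMeasure _)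
      else ⟨μ, hμ⟩ : ProbabilityMeasure (CurveClass ℂ)) : Measure (CurveClass ℂ)) = _
    rw [dif_pos hn]
    rfl
  have hweak : Tendsto ν' atTop (𝓝 (⟨μ, hμ⟩ : ProbabilityMeasure (CurveClass ℂ))) := by
    refine tendsto_iff_forall_lipschitz_integral_tendsto.2 fun g hgb hgl => ?_
    obtain ⟨L, hL⟩ := hgl
    let gb : CurveClass ℂ →ᵇ ℝ := ⟨⟨g, hL.continuous⟩, hgb⟩
    refine ((hB gb L hL).congr' ?_)
    filter_upwards [hν'] with n hn
    rw [hn]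
    rfl
  -- (iv) hence on `f`, and the difference tends to `∫ f dμ - ∫ f dμ = 0`
  have hC : Tendsto (fun n => ∫ x, f x ∂ν (s (φ n))) atTop (𝓝 (∫ x, f x ∂μ)) := by
    have h := (ProbabilityMeasure.tendsto_iff_forall_integral_tendsto.1 hweak) f
    refine h.congr' ?_
    filter_upwards [hν'] with n hn
    rw [hn]
  have h := (hA f).sub hC
  rwa [sub_self] at h

end Generic

/-! ### The proved leg: GM's Yang–Baxter law vs the compass law, on bounded Lipschitz functions -/

/-- **Port coupling at bounded-Lipschitz level, as an inequality.** For a solution of the compass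
equations, any domain `Ω`, mesh `δ`, ports `a, b` and a bounded `L`-Lipschitz `f`:
`‖∫ f (γ.curve) d ybLaw(π/2) Ω δ 1 a b − ∫ f d compassLaw α β s z Ω δ a b‖ ≤ L · |δ|`. Both laws are
push-forwards of ONE normalised compass path measure `ρ_δ` (landed `PortTransfer.ybLaw_eq_map`,
through the landed port dictionary `Sketch.stub_portDictionary`, and `PortTransfer.compassLaw_eq_map`)
along two drawings at distance `≤ |δ|` (`PortTransfer.dist_compassCurve_curve_le`); `ρ_δ` is `0`
or a probability measure. No limit, no tightness. [folklore] -/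
theorem norm_integral_yb_sub_compass_le {α β s z : ℝ} (hsol : IsCompassSolution α β s z)
    (Ω : Set ℂ) (δ : ℝ) (a b : MidEdge) (f : CurveClass ℂ →ᵇ ℝ) {L : ℝ≥0}
    (hf : LipschitzWith L f) :
    ‖(∫ γ, f (γ.curve rightAngles δ) ∂(ybLaw rightAngles Ω δ 1 a b)) -
        ∫ x, f x ∂(SAW.compassLaw α β s z Ω δ a b)‖ ≤ L * |δ| := by
  have hP : SAWCompassLattice.PortDictionary :=
    Summit.CriticalPhenomena.SAWScalingLimit.Cruxes.HexTransfer.Sketch.stub_portDictionary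
  have h1 : ∫ γ, f (γ.curve rightAngles δ) ∂(ybLaw rightAngles Ω δ 1 a b) =
      ∫ p, f ((PortTransfer.toYB hP hsol p).curve rightAngles δ)
        ∂(PortTransfer.compassRho α β s z Ω δ a b) := by
    change ∫ γ, f (γ.curve (fun (_ : ℤ) => Real.pi / 2) δ)
        ∂(ybLaw (fun (_ : ℤ) => Real.pi / 2) Ω δ 1 a b) = _
    rw [PortTransfer.ybLaw_eq_map hP hsol,
      integral_map (PortTransfer.measurable_cpath _).aemeasurable]
    exact (YBWalk.measurable_of_top _).aestronglyMeasurable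
  have h2 : ∫ x, f x ∂(SAW.compassLaw α β s z Ω δ a b) =
      ∫ p, f (PortTransfer.compassCurve δ p) ∂(PortTransfer.compassRho α β s z Ω δ a b) := by
    change ∫ x, f x ∂(PortTransfer.compassLaw α β s z Ω δ a b) = _
    rw [PortTransfer.compassLaw_eq_map,
      integral_map (PortTransfer.measurable_cpath _).aemeasurable f.continuous.aestronglyMeasurable]
  rw [h1, h2, ← norm_neg, neg_sub]
  have key := PortTransfer.norm_integral_sub_integral_le (ε := |δ|)
    (PortTransfer.compassRho_zero_or_prob α β s z Ω δ a b)
    (PortTransfer.measurable_cpath _).aemeasurable (PortTransfer.measurable_cpath _).aemeasurable f hf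
    (fun p => PortTransfer.dist_compassCurve_curve_le p (PortTransfer.toYB hP hsol p)
      (PortTransfer.toYB_mids hP hsol p))
  rwa [abs_abs] at key

/-- **The proved leg along `δ → 0⁺`**: GM's critical square-tiling law and the compass chordal law
merge on bounded Lipschitz test functions, for every solution of the compass equations, EVERY
domain and EVERY family of ports (no endpoint approximation, no limit, no tightness). [folklore] -/
theorem lipPortCoupling {α β s z : ℝ} (hsol : IsCompassSolution α β s z) (Ω : Set ℂ)
    (a b : ℝ → MidEdge) (f : CurveClass ℂ →ᵇ ℝ) {L : ℝ≥0} (hf : LipschitzWith L f) :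
    Tendsto (fun δ : ℝ => (∫ γ, f (γ.curve rightAngles δ) ∂(ybLaw rightAngles Ω δ 1 (a δ) (b δ))) -
        ∫ x, f x ∂(SAW.compassLaw α β s z Ω δ (a δ) (b δ))) (𝓝[>] (0 : ℝ)) (𝓝 0) := by
  have hε : Tendsto (fun δ : ℝ => (L : ℝ) * |δ|) (𝓝[>] (0 : ℝ)) (𝓝 0) := by
    have h0 : Tendsto (fun δ : ℝ => |δ|) (𝓝[>] (0 : ℝ)) (𝓝 0) :=
      (continuous_abs.tendsto' (0 : ℝ) 0 abs_zero).mono_left nhdsWithin_le_nhds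
    simpa using (tendsto_const_nhds (x := (L : ℝ))).mul h0
  exact squeeze_zero_norm (fun δ => norm_integral_yb_sub_compass_le hsol Ω δ (a δ) (b δ) f hf) hε

/-! ### The stub statements -/

/-- **The critical plus-lattice chordal law** of `Ω_δ` from port `a` to port `b`: self-avoiding
port–centre–port–…–port paths of the plus lattice (one centre per face of the square tiling, wired
to its four ports; `walkWeight_plusFugacity : weight = p ^ length`) whose centres are faces of
`meshFaces (π/2) Ω δ`, at the critical half-edge fugacity `p = √x_c` (a visited centre costs
`x_c = SAW.criticalFugacity`), normalised and pushed to `CurveClass ℂ` by the rescaled polyline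
through ports and centres. This is the critical `ℤ²` SAW on the face centres `δ(ℤ² + (1+i)/2)`
between the faces of the end ports — the `(u, v, w) = (x_c, x_c, 0)` point of GM's face-weight
family, on the SAME faces and ports as `ybLaw (π/2)`. (Birth writes this term inline; `plusLaw`
is it, by `rfl`.) [folklore] -/
def plusLaw (Ω : Set ℂ) (δ : ℝ) (a b : MidEdge) : Measure (CurveClass ℂ) :=
  PortGadget.pathLaw plusLattice (plusFugacity (Real.sqrt SAW.criticalFugacity))
    (PortGadget.embed plusPos) (PortGadget.inFaces (meshFaces rightAngles Ω δ)) δ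
    (Sum.inl a) (Sum.inl b)

/-- Statement of stub 2 (**the plus point is `ℤ²`, at bounded-Lipschitz level**; `ℤ²` only): for
every Dobrushin domain, every `ℤ²` endpoint approximation `(a, b)` and every port endpoint
approximation `(a', b')` at `Θ ≡ π/2`, the critical `δℤ²` SAW law of the summit and the critical
plus-lattice law between the ports merge on bounded LIPSCHITZ test functions. Content: the
deterministic parts (half-mesh translation `ℤ² + ½ ↔ ℤ²`, polyline through ports-and-centres vs
through centres) cost `≤ δ` in `CurveClass ℂ` and are FREE at Lipschitz level (cf.
`lipPortCoupling`); what remains is insensitivity IN BOUNDED-LIPSCHITZ DISTANCE of the critical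
chordal `ℤ²` law to the `O(δ)` boundary layer of the discretisation (`discreteDomainGraph` vs faces
of `meshFaces`) and to an `o(1)` displacement of the boundary endpoints — a statement about ONE
model (no universality content), strictly weaker than birth's `PlusPointIsZ2`
(`lipPlusPointIsZ2_of_cb`). [cite: LawlerSchrammWerner2004SAW, §3.4.2 (independence of the
lattice approximation of domain and endpoints, conjectural)] -/
def LipPlusPointIsZ2 : Prop :=
  ∀ (D : DobrushinDomain) (a b : ℝ → Site 2) (a' b' : ℝ → MidEdge),
    SAW.IsEndpointApprox D a b → IsYBEndpointApprox rightAngles D a' b' →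
    ∀ (f : BoundedContinuousFunction (CurveClass ℂ) ℝ) (L : ℝ≥0), LipschitzWith L f →
      Tendsto (fun δ : ℝ => (∫ γ, f γ.curve ∂(SAW.law D.carrier δ (a δ) (b δ))) -
          ∫ x, f x ∂(plusLaw D.carrier δ (a' δ) (b' δ))) (𝓝[>] (0 : ℝ)) (𝓝 0)

/-- Statement of stub 3 (**THE KERNEL: plus point vs Yang–Baxter point, at bounded-Lipschitz
level**; hardest): for every Dobrushin domain and every port endpoint approximation at `Θ ≡ π/2`,
the critical plus-lattice law (uniform `ℤ²` SAW on the face centres, face weights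
`(u, v, w) = (x_c, x_c, 0)`) and Glazman–Manolescu's critical Yang–Baxter law on the square tiling
(`ybLaw (π/2) Ω δ 1 a' b'`, face weights `(u₁, v, w₁)(π/2) = (0.4084, 0.3209, 0.1127)`, drawn by
`YBWalk.curve`) — SAME faces, SAME ports, SAME endpoints — merge on bounded Lipschitz test
functions; equivalently their bounded-Lipschitz (Dudley) distance tends to `0`, i.e. for small `δ`
the two walks can be coupled to be uniformly close with high probability. This is planar SAW
universality between the uniform and the integrable `n = 0` point of the square lattice, with the
topology (tightness) and the conventions factored out. [cite: GlazmanManolescu2019, §1 and Thm. 3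
(the integrable square-lattice walk; scalar universality only)] [cite: Beffara2008Universal, §1–2] -/
def LipPlusToYB : Prop :=
  ∀ (D : DobrushinDomain) (a' b' : ℝ → MidEdge), IsYBEndpointApprox rightAngles D a' b' →
    ∀ (f : BoundedContinuousFunction (CurveClass ℂ) ℝ) (L : ℝ≥0), LipschitzWith L f →
      Tendsto (fun δ : ℝ => (∫ x, f x ∂(plusLaw D.carrier δ (a' δ) (b' δ))) -
          ∫ γ, f (γ.curve rightAngles δ) ∂(ybLaw rightAngles D.carrier δ 1 (a' δ) (b' δ)))
        (𝓝[>] (0 : ℝ)) (𝓝 0)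

/-! ### Registered stubs -/

/-- Stub 1 (L–XL, open, SHARED: by name the item stmt-CriticalPhenomena-1881
`SAWParafermion.EventualTight`, wanted by 15 routes; implied by the `(0, δ₀]`-form stmt-1372 via
`isTightAlongMesh_of_isTightMeasureSet_image`): eventual tightness of the critical `ℤ²` SAW curve
laws. The only `C_b`-strength input of the line; necessary in kind for the summit along sequences. -/
theorem stub_tightZ2 : SAWParafermion.EventualTight := by
  sorry

/-- Stub 2 (M–XL; `ℤ²` only): the plus point is `ℤ²` at bounded-Lipschitz level (conventions +
boundary-layer / endpoint locality of the critical chordal `ℤ²` law in Dudley distance). -/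
theorem stub_lipPlusPointIsZ2 : LipPlusPointIsZ2 := by
  sorry

/-- Stub 3 (XL, open; HARDEST — the universality kernel): plus point vs Yang–Baxter point of GM's
face-weight family on one scaffold, at bounded-Lipschitz level. -/
theorem stub_lipPlusToYB : LipPlusToYB := by
  sorry

/-! ### Composition (sorry-free) -/

/-- **Bounded-Lipschitz merging of the `ℤ²` law and the compass law** from stubs 2, 3 and the
proved port coupling: `(∫dP^{ℤ²} − ∫dPlus) + (∫dPlus − ∫dYB) + (∫dYB − ∫dCompass) → 0`. [folklore] -/
theorem lipMerge_of_hyps (hZ : LipPlusPointIsZ2) (hK : LipPlusToYB) {α β s z : ℝ}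
    (hsol : IsCompassSolution α β s z) (D : DobrushinDomain) (a b : ℝ → Site 2)
    (a' b' : ℝ → MidEdge) (hab : SAW.IsEndpointApprox D a b)
    (hab' : IsYBEndpointApprox rightAngles D a' b') (f : CurveClass ℂ →ᵇ ℝ) (L : ℝ≥0)
    (hf : LipschitzWith L f) :
    Tendsto (fun δ : ℝ => (∫ γ, f γ.curve ∂(SAW.law D.carrier δ (a δ) (b δ))) -
        ∫ x, f x ∂(SAW.compassLaw α β s z D.carrier δ (a' δ) (b' δ))) (𝓝[>] (0 : ℝ)) (𝓝 0) := by
  have h := ((hZ D a b a' b' hab hab' f L hf).add (hK D a' b' hab' f L hf)).add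
    (lipPortCoupling hsol D.carrier a' b' f hf)
  rw [add_zero, add_zero] at h
  exact h.congr fun δ => by ring

/-- **`EventualTight → LipPlusPointIsZ2 → LipPlusToYB →` the crux, de-`let`-ed** (the right-hand
side of `Surface.surfaceUniversality_iff`): the one-sided Prokhorov upgrade
`tendsto_sub_of_isTightAlongMesh` applied to the tight `ℤ²` side (`SAW.law` is a probability
measure for small `δ`, `SubseqIdentification.Negative.eventually_isProbabilityMeasure_law`; the
curve observable is measurable) and the compass side (a probability measure for small `δ`,
`Surface.eventually_isProbabilityMeasure_compassLaw_of_isCompassSolution`), with the Lipschitz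
merging `lipMerge_of_hyps`. [folklore] -/
theorem surfaceUniversality_of_hyps (hT : SAWParafermion.EventualTight) (hZ : LipPlusPointIsZ2)
    (hK : LipPlusToYB) :
    ∀ (α β s z : ℝ), IsCompassSolution α β s z →
      ∀ (D : DobrushinDomain) (a b : ℝ → Site 2) (a' b' : ℝ → MidEdge),
        SAW.IsEndpointApprox D a b → IsYBEndpointApprox rightAngles D a' b' →
        ∀ f : BoundedContinuousFunction (CurveClass ℂ) ℝ,
          Tendsto (fun δ : ℝ => (∫ γ, f γ.curve ∂(SAW.law D.carrier δ (a δ) (b δ))) -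
              ∫ x, f x ∂(SAW.compassLaw α β s z D.carrier δ (a' δ) (b' δ))) (𝓝[>] (0 : ℝ)) (𝓝 0) := by
  intro α β s z hsol D a b a' b' hab hab' f
  exact tendsto_sub_of_isTightAlongMesh
    (Theorems.SubseqIdentification.Negative.eventually_isProbabilityMeasure_law hab)
    (Filter.Eventually.of_forall fun δ => SAW.aemeasurable_curve D.carrier δ (a δ) (b δ))
    (hT D a b hab)
    (Surface.eventually_isProbabilityMeasure_compassLaw_of_isCompassSolution hsol D hab')
    (fun g L hg => lipMerge_of_hyps hZ hK hsol D a b a' b' hab hab' g L hg) f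

/-- **The crux from the line's registered stubs, concluded BY NAME**:
`SAWCompassLattice.SurfaceUniversality` (item stmt-CriticalPhenomena-6964) from `stub_tightZ2`,
`stub_lipPlusPointIsZ2`, `stub_lipPlusToYB`, through the landed de-`let`-ing
`Surface.surfaceUniversality_iff` (`Iff.rfl`). -/
theorem SurfaceUniversality_of : SAWCompassLattice.SurfaceUniversality :=
  Surface.surfaceUniversality_iff.2
    (surfaceUniversality_of_hyps stub_tightZ2 stub_lipPlusPointIsZ2 stub_lipPlusToYB)

/-! ### Cross-references (sorry-free given their hypotheses; not stubs) -/

/-- `SAWTrackTransport.YBtoUniform` (stmt-CriticalPhenomena-16966) restricted to bounded Lipschitz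
test functions: the `ℤ²` law vs GM's square-tiling law. [folklore] -/
def LipYBtoUniform : Prop :=
  ∀ (D : DobrushinDomain) (a b : ℝ → Site 2) (a' b' : ℝ → MidEdge),
    SAW.IsEndpointApprox D a b → IsYBEndpointApprox rightAngles D a' b' →
    ∀ (f : BoundedContinuousFunction (CurveClass ℂ) ℝ) (L : ℝ≥0), LipschitzWith L f →
      Tendsto (fun δ : ℝ => (∫ γ, f γ.curve ∂(SAW.law D.carrier δ (a δ) (b δ))) -
          ∫ γ, f (γ.curve rightAngles δ) ∂(ybLaw rightAngles D.carrier δ 1 (a' δ) (b' δ)))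
        (𝓝[>] (0 : ℝ)) (𝓝 0)

/-- Stubs 2 + 3 give `LipYBtoUniform` (add). [folklore] -/
theorem lipYBtoUniform_of_stubs (hZ : LipPlusPointIsZ2) (hK : LipPlusToYB) : LipYBtoUniform := by
  intro D a b a' b' hab hab' f L hf
  have h := (hZ D a b a' b' hab hab' f L hf).add (hK D a' b' hab' f L hf)
  rw [add_zero] at h
  exact h.congr fun δ => sub_add_sub_cancel _ _ _

/-- The `C_b` toll `YBtoUniform` (stmt-16966) trivially gives its Lipschitz restriction. [folklore] -/
theorem lipYBtoUniform_of_ybToUniform (h : SAWTrackTransport.YBtoUniform) : LipYBtoUniform :=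
  fun D a b a' b' hab hab' f _ _ => h D a b a' b' hab hab' f

/-- Birth's stub 1 (`C_b` level) restricted to Lipschitz functions is stub 2 of this line: the
present stub is WEAKER. (Birth's `PlusPointIsZ2` restated verbatim, to avoid importing a file with
`sorry`.) [folklore] -/
theorem lipPlusPointIsZ2_of_cb
    (h : ∀ (D : DobrushinDomain) (a b : ℝ → Site 2) (a' b' : ℝ → MidEdge),
      SAW.IsEndpointApprox D a b → IsYBEndpointApprox rightAngles D a' b' →
      ∀ f : BoundedContinuousFunction (CurveClass ℂ) ℝ,
        Tendsto (fun δ : ℝ => (∫ γ, f γ.curve ∂(SAW.law D.carrier δ (a δ) (b δ))) -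
            ∫ x, f x ∂(PortGadget.pathLaw plusLattice (plusFugacity (Real.sqrt SAW.criticalFugacity))
              (PortGadget.embed plusPos) (PortGadget.inFaces (meshFaces rightAngles D.carrier δ)) δ
              (Sum.inl (a' δ)) (Sum.inl (b' δ))))
          (𝓝[>] (0 : ℝ)) (𝓝 0)) :
    LipPlusPointIsZ2 :=
  fun D a b a' b' hab hab' f _ _ => h D a b a' b' hab hab' f

end Summit.CriticalPhenomena.SAWScalingLimit.Cruxes.SurfaceUniversality.LipschitzToll

end
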